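import Summits.NavierStokesRegularity.NavierStokesRegularity.Theorems.PerpetualPumpAveragedTypeIBlowupKernel

/-!
# Crux `PerpetualPump.AveragedTypeIBlowup` (stmt-NavierStokesRegularity-1835), line `Sketch`:
# stub `kernelDeriv` — the mode heat kernel as a smooth, pinched frequency integral

T. Tao, *Finite time blowup for an averaged three-dimensional Navier–Stokes equation*, J. Amer.
Math. Soc. **29** (2016), 601–674 = arXiv:1402.0290v3, §4, proof of Lemma 4.1, p. 22, (4.14).
Pairing (4.14) with `ψ_{i,n}` gives the exact Volterra chain of the wavelet coefficients, with kernel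
the heat kernel of the mode, `k_{i,n}(τ) = Re⟨e^{τΔ}ψ_{i,n}, ψ_{i,n}⟩`; on the Fourier side
(accepted `re_pairing_heat_cascadeWavelet_self`)
`k_{i,n}(τ) = ∫ e^{-λ(ξ) max(τ,0)} ρ_{i,n}(ξ) dξ`, `λ(ξ) = 4π²|ξ|²` (`heatRate`),
`ρ_{i,n} = |ψ̂_{i,n}|²` (`modeWeight`, a probability density living on the frequency region
`(1+ε₀)ⁿ·(Bᵢ ∪ -Bᵢ)` of the mode).

This file proves the registered stub `stub_kernelDeriv` of the line's skeleton, verbatim. For wavelet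
data whose Fourier balls `Bᵢ = B(cᵢ, rᵢ)` are THIN, `rᵢ ≤ r < ρ₀ = |cᵢ|`, every frequency of the
region of the mode `(i,n)` has `(ρ₀ - r)(1+ε₀)ⁿ ≤ |ξ| ≤ (ρ₀ + r)(1+ε₀)ⁿ`
(`norm_of_mem_freqRegion_thin`), so the heat rate is pinched there,
`4π²(ρ₀-r)²(1+ε₀)^{2n} ≤ λ(ξ) ≤ 4π²(ρ₀+r)²(1+ε₀)^{2n}` (`heatRate_mem_freqRegion_thin`). Hence:

* for `τ ≥ 0` the kernel is the frequency integral `g(τ) = ∫ e^{-λ(ξ)τ} ρ_{i,n}(ξ) dξ`;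
* `g` is differentiable at every real `τ`, `g'(τ) = -∫ λ(ξ) e^{-λ(ξ)τ} ρ_{i,n}(ξ) dξ`, and this
  derivative is continuous (differentiation under the frequency integral: `e^{-λt}` is the accepted
  scalar Duhamel function `duhamelScalar 1 0 λ t` with zero forcing, and the accepted
  `hasDerivAt_integral_duhamelScalar_pow` differentiates `∫ φ_λ(t) w(ξ) dξ` for every integrable
  weight supported in a ball — here `w = ρ_{i,n}` and `w = λ ρ_{i,n}`);
* the PINCHING `4π²(ρ₀-r)²(1+ε₀)^{2n} g ≤ -g' ≤ 4π²(ρ₀+r)²(1+ε₀)^{2n} g` and `g ≥ 0` (monotonicity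
  of the integral against the a.e. two-sided bound on `λ` on the support of the weight).

Nothing here closes the item (`--supports`); no statement of the route changes.

## References

* T. Tao, J. Amer. Math. Soc. 29 (2016), 601–674, arXiv:1402.0290v3, §4 Lemma 4.1, p. 22
  ((4.14)). [`Tao2016AveragedNS`]
-/

noncomputable section

-- the summit namespace `…NavierStokesRegularity.NavierStokesRegularity…` is the tree convention
set_option linter.dupNamespace false

open MeasureTheory Set Filter Topology Metric
open scoped ENNReal
open Literature.Analysis.FluidPDE Literature.Analysis.FluidPDE.Tao2016
open Literature.Analysis.FluidPDE.TaoCascade (quadTerm IsSymmetricCoeff IsCancellingCoeff)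

namespace Summit.NavierStokesRegularity.NavierStokesRegularity.Theorems.PerpetualPumpAveragedTypeIBlowup

variable {ε₀ : ℝ} {m : ℕ}

/-! ### Thin Fourier balls pinch the frequencies and the heat rate of a mode -/

/-- **Frequencies of a thin mode.** If the ball `Bᵢ` has radius `≤ r` and centre of norm `ρ₀`, then
every `ξ ∈ (1+ε₀)ⁿ·(Bᵢ ∪ -Bᵢ)` has `(ρ₀ - r)(1+ε₀)ⁿ ≤ |ξ| ≤ (ρ₀ + r)(1+ε₀)ⁿ` (triangle
inequality for the rescaled frequency `(1+ε₀)⁻ⁿξ ∈ Bᵢ ∪ -Bᵢ`). [cite: Tao2016AveragedNS, §4 Lemma 4.1] -/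
theorem norm_of_mem_freqRegion_thin (hε : 0 < 1 + ε₀) (𝒟 : CascadeWaveletData ε₀ m) {ρ₀ r : ℝ}
    {i : Fin m} (hD : 𝒟.radius i ≤ r ∧ ‖𝒟.center i‖ = ρ₀) (n : ℤ) {ξ : EuclideanSpace ℝ (Fin 3)}
    (h : ξ ∈ freqRegion 𝒟 i n) :
    (ρ₀ - r) * (1 + ε₀) ^ n ≤ ‖ξ‖ ∧ ‖ξ‖ ≤ (ρ₀ + r) * (1 + ε₀) ^ n := by
  have hc : 0 < (1 + ε₀) ^ n := zpow_pos hε n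
  -- a point of `Bᵢ` has norm within `r` of `ρ₀`
  have key : ∀ {η : EuclideanSpace ℝ (Fin 3)}, η ∈ ball (𝒟.center i) (𝒟.radius i) →
      ρ₀ - r < ‖η‖ ∧ ‖η‖ < ρ₀ + r := by
    intro η hη
    rw [mem_ball, dist_eq_norm] at hη
    have h1 : |‖η‖ - ‖𝒟.center i‖| < r :=
      ((abs_norm_sub_norm_le η (𝒟.center i)).trans_lt hη).trans_le hD.1
    rw [hD.2, abs_sub_lt_iff] at h1
    constructor <;> linarith [h1.1, h1.2]
  have hnorm : ‖((1 + ε₀) ^ n)⁻¹ • ξ‖ = ((1 + ε₀) ^ n)⁻¹ * ‖ξ‖ := by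
    rw [norm_smul, norm_inv, Real.norm_of_nonneg hc.le]
  have hb : ρ₀ - r < ((1 + ε₀) ^ n)⁻¹ * ‖ξ‖ ∧ ((1 + ε₀) ^ n)⁻¹ * ‖ξ‖ < ρ₀ + r := by
    rcases (𝒟.mem_freqRegion_iff i n ξ).1 h with hη | hη
    · rw [← hnorm]
      exact key hη
    · rw [← hnorm, ← norm_neg]
      exact key hη
  rw [lt_inv_mul_iff₀ hc, inv_mul_lt_iff₀ hc] at hb
  constructor <;> nlinarith [hb.1, hb.2]

/-- **The heat rate of a thin mode is pinched**: under the hypotheses of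
`norm_of_mem_freqRegion_thin` and `r ≤ ρ₀`, every `ξ` of the frequency region of the mode `(i,n)` has
`4π²(ρ₀-r)²(1+ε₀)^{2n} ≤ λ(ξ) ≤ 4π²(ρ₀+r)²(1+ε₀)^{2n}`. [cite: Tao2016AveragedNS, §4 Lemma 4.1] -/
theorem heatRate_mem_freqRegion_thin (hε : 0 < 1 + ε₀) (𝒟 : CascadeWaveletData ε₀ m) {ρ₀ r : ℝ}
    (hr : r ≤ ρ₀) {i : Fin m} (hD : 𝒟.radius i ≤ r ∧ ‖𝒟.center i‖ = ρ₀) (n : ℤ)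
    {ξ : EuclideanSpace ℝ (Fin 3)} (h : ξ ∈ freqRegion 𝒟 i n) :
    4 * Real.pi ^ 2 * (ρ₀ - r) ^ 2 * (1 + ε₀) ^ (2 * n) ≤ heatRate ξ ∧
      heatRate ξ ≤ 4 * Real.pi ^ 2 * (ρ₀ + r) ^ 2 * (1 + ε₀) ^ (2 * n) := by
  obtain ⟨h1, h2⟩ := norm_of_mem_freqRegion_thin hε 𝒟 hD n h
  have hc : 0 < (1 + ε₀) ^ n := zpow_pos hε n
  have hsq : (1 + ε₀) ^ (2 * n) = ((1 + ε₀) ^ n) ^ 2 := by rw [zpow_mul', zpow_ofNat]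
  have hlo : 0 ≤ (ρ₀ - r) * (1 + ε₀) ^ n := mul_nonneg (sub_nonneg.2 hr) hc.le
  rw [heatRate, hsq]
  constructor
  · calc 4 * Real.pi ^ 2 * (ρ₀ - r) ^ 2 * ((1 + ε₀) ^ n) ^ 2
        = 4 * Real.pi ^ 2 * ((ρ₀ - r) * (1 + ε₀) ^ n) ^ 2 := by ring
      _ ≤ 4 * Real.pi ^ 2 * ‖ξ‖ ^ 2 :=
        mul_le_mul_of_nonneg_left (pow_le_pow_left₀ hlo h1 2) (by positivity)
  · calc 4 * Real.pi ^ 2 * ‖ξ‖ ^ 2 ≤ 4 * Real.pi ^ 2 * ((ρ₀ + r) * (1 + ε₀) ^ n) ^ 2 :=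
        mul_le_mul_of_nonneg_left (pow_le_pow_left₀ (norm_nonneg _) h2 2) (by positivity)
      _ = 4 * Real.pi ^ 2 * (ρ₀ + r) ^ 2 * ((1 + ε₀) ^ n) ^ 2 := by ring

/-! ### The kernel as a smooth frequency integral (every real time) -/

/-- The damping factor `e^{-Lt}` is the scalar Duhamel function `φ_L(t) = e^{-Lt}(δ + ∫₀ᵗ Qr e^{Ls})`
with `δ = 1` and zero forcing. [folklore] -/
theorem exp_neg_mul_eq_duhamelScalar (L t : ℝ) :
    Real.exp (-(L * t)) = duhamelScalar 1 (fun _ => 0) L t := by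
  simp [duhamelScalar]

/-- The kernel integrand `e^{-λ(ξ)τ} ρ_{i,n}(ξ)` is integrable for EVERY real `τ` (also `τ < 0`: the
weight lives in a ball, where the rate is bounded). [folklore] -/
theorem integrable_exp_heatRate_mul_modeWeight (hε : 0 < 1 + ε₀) (𝒟 : CascadeWaveletData ε₀ m)
    (i : Fin m) (n : ℤ) (τ : ℝ) :
    Integrable (fun ξ : EuclideanSpace ℝ (Fin 3) =>
      Real.exp (-(heatRate ξ * τ)) * modeWeight 𝒟 i n ξ) := by
  have h := integrable_duhamelScalar_pow_mul (δ := 1) (Qr := fun _ => 0) continuous_const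
    (integrable_modeWeight (𝒟 := 𝒟) (i := i) (n := n))
    (modeWeight_eq_zero (𝒟 := 𝒟) (i := i) (n := n) hε) 1 τ
  refine h.congr (Eventually.of_forall fun ξ => ?_)
  simp only [pow_one, ← exp_neg_mul_eq_duhamelScalar]

/-- The derivative integrand `λ(ξ) e^{-λ(ξ)τ} ρ_{i,n}(ξ)` is integrable for every real `τ`. [folklore] -/
theorem integrable_heatRate_mul_exp_mul_modeWeight (hε : 0 < 1 + ε₀) (𝒟 : CascadeWaveletData ε₀ m)
    (i : Fin m) (n : ℤ) (τ : ℝ) :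
    Integrable (fun ξ : EuclideanSpace ℝ (Fin 3) =>
      heatRate ξ * Real.exp (-(heatRate ξ * τ)) * modeWeight 𝒟 i n ξ) := by
  have h := integrable_duhamelScalar_pow_mul (δ := 1) (Qr := fun _ => 0) continuous_const
    (integrable_heatRate_mul_modeWeight (𝒟 := 𝒟) (i := i) (n := n) hε)
    (heatRate_mul_modeWeight_eq_zero (𝒟 := 𝒟) (i := i) (n := n) hε) 1 τ
  refine h.congr (Eventually.of_forall fun ξ => ?_)
  simp only [pow_one, ← exp_neg_mul_eq_duhamelScalar]
  ring

/-- **Differentiation under the frequency integral**: `g(τ) = ∫ e^{-λ(ξ)τ} ρ_{i,n}(ξ) dξ` is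
differentiable at every real `τ` with `g'(τ) = -∫ λ(ξ) e^{-λ(ξ)τ} ρ_{i,n}(ξ) dξ` (the accepted
dominated differentiation `hasDerivAt_integral_duhamelScalar_pow`, zero forcing, `k = 1`). [folklore] -/
theorem hasDerivAt_integral_exp_heatRate_mul_modeWeight (hε : 0 < 1 + ε₀)
    (𝒟 : CascadeWaveletData ε₀ m) (i : Fin m) (n : ℤ) (τ : ℝ) :
    HasDerivAt (fun σ : ℝ => ∫ ξ, Real.exp (-(heatRate ξ * σ)) * modeWeight 𝒟 i n ξ)
      (-∫ ξ, heatRate ξ * Real.exp (-(heatRate ξ * τ)) * modeWeight 𝒟 i n ξ) τ := by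
  have h := (hasDerivAt_integral_duhamelScalar_pow (δ := 1) (Qr := fun _ => 0) continuous_const
    (integrable_modeWeight (𝒟 := 𝒟) (i := i) (n := n))
    (modeWeight_eq_zero (𝒟 := 𝒟) (i := i) (n := n) hε) 1 τ).2
  have hF : (fun t : ℝ => ∫ ξ, duhamelScalar 1 (fun _ => 0) (heatRate ξ) t ^ 1 * modeWeight 𝒟 i n ξ) =
      fun σ : ℝ => ∫ ξ, Real.exp (-(heatRate ξ * σ)) * modeWeight 𝒟 i n ξ := by
    funext t
    simp only [pow_one, ← exp_neg_mul_eq_duhamelScalar]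
  rw [hF] at h
  refine h.congr_deriv ?_
  rw [← integral_neg]
  refine integral_congr_ae (Eventually.of_forall fun ξ => ?_)
  simp only [← exp_neg_mul_eq_duhamelScalar, Nat.cast_one, Nat.sub_self, pow_zero]
  ring

/-- **Continuity of the derivative**: `τ ↦ ∫ λ(ξ) e^{-λ(ξ)τ} ρ_{i,n}(ξ) dξ` is continuous on `ℝ`
(it is itself differentiable under the integral sign, with the integrable weight `λ ρ_{i,n}`). [folklore] -/
theorem continuous_integral_heatRate_mul_exp_mul_modeWeight (hε : 0 < 1 + ε₀)
    (𝒟 : CascadeWaveletData ε₀ m) (i : Fin m) (n : ℤ) :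
    Continuous (fun τ : ℝ => ∫ ξ, heatRate ξ * Real.exp (-(heatRate ξ * τ)) * modeWeight 𝒟 i n ξ) := by
  have hF : (fun τ : ℝ => ∫ ξ, heatRate ξ * Real.exp (-(heatRate ξ * τ)) * modeWeight 𝒟 i n ξ) =
      fun t : ℝ => ∫ ξ, duhamelScalar 1 (fun _ => 0) (heatRate ξ) t ^ 1 *
        (heatRate ξ * modeWeight 𝒟 i n ξ) := by
    funext t
    refine integral_congr_ae (Eventually.of_forall fun ξ => ?_)
    simp only [pow_one, ← exp_neg_mul_eq_duhamelScalar]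
    ring
  rw [hF]
  exact continuous_iff_continuousAt.2 fun t =>
    (hasDerivAt_integral_duhamelScalar_pow (δ := 1) (Qr := fun _ => 0) continuous_const
      (integrable_heatRate_mul_modeWeight (𝒟 := 𝒟) (i := i) (n := n) hε)
      (heatRate_mul_modeWeight_eq_zero (𝒟 := 𝒟) (i := i) (n := n) hε) 1 t).2.continuousAt

/-! ### The registered stub -/

/-- **Registered stub `stub_kernelDeriv`** (L1c-i). For wavelet data whose balls have centres on
`|ξ| = ρ₀` and radii `≤ r < ρ₀`, the mode heat kernel `k_{i,n}(τ) = Re⟨e^{τΔ}ψ_{i,n}, ψ_{i,n}⟩` agrees on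
`τ ≥ 0` with the smooth frequency integral `g(τ) = ∫ e^{-λ(ξ)τ} |ψ̂_{i,n}(ξ)|² dξ` (`λ(ξ) = 4π²|ξ|²`),
whose derivative `g'(τ) = -∫ λ(ξ) e^{-λ(ξ)τ} |ψ̂_{i,n}|²` (at every real `τ`) is continuous and PINCHED:
`4π²(ρ₀-r)²(1+ε₀)^{2n} g ≤ -g' ≤ 4π²(ρ₀+r)²(1+ε₀)^{2n} g` and `g ≥ 0` on `τ ≥ 0` (the weight lives on
`(ρ₀-r)(1+ε₀)ⁿ ≤ |ξ| ≤ (ρ₀+r)(1+ε₀)ⁿ`; differentiation under the integral sign). [cite: Tao2016AveragedNS, §4 p. 22 (4.14)] -/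
theorem stub_kernelDeriv :
    ∀ {ε₀ : ℝ}, 0 < ε₀ → ε₀ ≤ 1 → ∀ {m : ℕ} (𝒟 : CascadeWaveletData ε₀ m) (ρ₀ r : ℝ), 0 < r → r < ρ₀ →
      (∀ i, 𝒟.radius i ≤ r ∧ ‖𝒟.center i‖ = ρ₀) →
      ∀ (i : Fin m) (n : ℤ),
        (∀ τ : ℝ, 0 ≤ τ →
          (pairing (heat τ (cascadeWavelet ε₀ (𝒟.ψ i) n)) (cascadeWavelet ε₀ (𝒟.ψ i) n)).re =
            ∫ ξ, Real.exp (-(heatRate ξ * τ)) * modeWeight 𝒟 i n ξ) ∧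
        (∀ τ : ℝ, HasDerivAt (fun σ : ℝ => ∫ ξ, Real.exp (-(heatRate ξ * σ)) * modeWeight 𝒟 i n ξ)
          (-∫ ξ, heatRate ξ * Real.exp (-(heatRate ξ * τ)) * modeWeight 𝒟 i n ξ) τ) ∧
        Continuous (fun τ : ℝ => ∫ ξ, heatRate ξ * Real.exp (-(heatRate ξ * τ)) * modeWeight 𝒟 i n ξ) ∧
        (∀ τ : ℝ, 0 ≤ τ →
          0 ≤ ∫ ξ, Real.exp (-(heatRate ξ * τ)) * modeWeight 𝒟 i n ξ ∧
          4 * Real.pi ^ 2 * (ρ₀ - r) ^ 2 * (1 + ε₀) ^ (2 * n) *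
              (∫ ξ, Real.exp (-(heatRate ξ * τ)) * modeWeight 𝒟 i n ξ) ≤
            ∫ ξ, heatRate ξ * Real.exp (-(heatRate ξ * τ)) * modeWeight 𝒟 i n ξ ∧
          (∫ ξ, heatRate ξ * Real.exp (-(heatRate ξ * τ)) * modeWeight 𝒟 i n ξ) ≤
            4 * Real.pi ^ 2 * (ρ₀ + r) ^ 2 * (1 + ε₀) ^ (2 * n) *
              ∫ ξ, Real.exp (-(heatRate ξ * τ)) * modeWeight 𝒟 i n ξ) := by
  intro ε₀ hε₀ _ m 𝒟 ρ₀ r _ hrρ hD i n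
  have hε : 0 < 1 + ε₀ := by linarith
  refine ⟨fun τ hτ => ?_, fun τ => hasDerivAt_integral_exp_heatRate_mul_modeWeight hε 𝒟 i n τ,
    continuous_integral_heatRate_mul_exp_mul_modeWeight hε 𝒟 i n, fun τ _ => ⟨?_, ?_, ?_⟩⟩
  · -- the kernel on `τ ≥ 0`
    rw [re_pairing_heat_cascadeWavelet_self, max_eq_left hτ]
  · -- nonnegativity
    exact integral_nonneg fun ξ => mul_nonneg (Real.exp_pos _).le (modeWeight_nonneg ξ)
  · -- lower pinching
    rw [← integral_const_mul]
    refine integral_mono_ae ((integrable_exp_heatRate_mul_modeWeight hε 𝒟 i n τ).const_mul _)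
      (integrable_heatRate_mul_exp_mul_modeWeight hε 𝒟 i n τ) ?_
    filter_upwards [modeWeight_eq_zero_of_not_mem hε 𝒟 i n] with ξ hξ
    by_cases hmem : ξ ∈ freqRegion 𝒟 i n
    · rw [← mul_assoc]
      exact mul_le_mul_of_nonneg_right (mul_le_mul_of_nonneg_right
        (heatRate_mem_freqRegion_thin hε 𝒟 hrρ.le (hD i) n hmem).1 (Real.exp_pos _).le)
        (modeWeight_nonneg ξ)
    · simp only [hξ hmem, mul_zero, le_refl]
  · -- upper pinching
    rw [← integral_const_mul]
    refine integral_mono_ae (integrable_heatRate_mul_exp_mul_modeWeight hε 𝒟 i n τ)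
      ((integrable_exp_heatRate_mul_modeWeight hε 𝒟 i n τ).const_mul _) ?_
    filter_upwards [modeWeight_eq_zero_of_not_mem hε 𝒟 i n] with ξ hξ
    by_cases hmem : ξ ∈ freqRegion 𝒟 i n
    · rw [← mul_assoc]
      exact mul_le_mul_of_nonneg_right (mul_le_mul_of_nonneg_right
        (heatRate_mem_freqRegion_thin hε 𝒟 hrρ.le (hD i) n hmem).2 (Real.exp_pos _).le)
        (modeWeight_nonneg ξ)
    · simp only [hξ hmem, mul_zero, le_refl]

end Summit.NavierStokesRegularity.NavierStokesRegularity.Theorems.PerpetualPumpAveragedTypeIBlowup
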